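import Literature.Computability.AlgebraicComplexity.TokenExpansionMain
import Literature.Computability.AlgebraicComplexity.VP0Normal
import Literature.Computability.AlgebraicComplexity.ConstantFreeCompleteness
import Literature.LinearAlgebra.Matrix.PermanentLaplace
import HarnessLib

/-!
# Bürgisser 2009, Thm. 2.10: discharge of `Burgisser2009_perProjection` and `Burgisser2009_thm210`

D-0014 keeps `Literature/` free of `sorry` by stating cited results as named facts. This file
PROVES the named fact `Burgisser2009_thm210` of `BurgisserTransfer.lean` — Bürgisser,
*On defining integers and proving arithmetic circuit lower bounds* (Comput. Complexity 18, 2009;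
ECCC TR06-113, Thm. 2.10, p. 8 = Koiran 2004, Thm. 4.3):
`τ(PER_n) = n^{O(1)} ⟹ ∀ (f_n) ∈ VNP⁰ ∃ p, τ(2^{p(n)} f_n) = n^{O(1)}` — through its algebraic
content `ConstantFreeCompleteness.Burgisser2009_perProjection` ("by inspecting Valiant's
completeness proof, `2^{p(n)} f_n` is the permanent of a matrix with entries `2 y`, `y` a
variable or a small constant"), of which `Burgisser2009_thm210_of` already derived Thm. 2.10.

The inspection is carried out on a self-contained completeness proof assembled from the sibling
files (all proved):
1. `VP0Normal.lean` — the `VP⁰` circuit `C_n` of `g_n` (`f_n = ∑_e g_n(X, e)`) becomes a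
   normalized circuit `N` over `ℤ[X]` with the Boolean variables as its first leaves
   (`ArithCircuit.toNCirc`, `val_root`, `fd_root`, `paramIn_kindC`; gates of formal degree `0`
   are collapsed to constant leaves `C c` with `τ(C c) ≤ |C_n|`);
2. `TokenCircuits.lean` — its clones `(node, offset)` and tokens form a factor system in which
   every Boolean variable is read by exactly two factors (`NCirc.FS`);
3. `FactorSystems.lean` (with `ValiantKitBlocks.lean`, `PermanentBooleanSum*.lean`) — such a
   factor system is the permanent of a matrix `B` with entries `0, ±1` and the parameters:
   `per B = 2^{#V} ∑_{b} ∏_f F f b` (read-once kit blocks + the two-site Boolean-sum gadget);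
4. `TokenExpansion*.lean` — `∑_b ∏_f F f b = ∑_e val_e(root) = ∑_e g_n(X, e) = f_n`
   (`NCirc.sum_prod_factors`, the cut induction);
5. here — `exists_permanent_boolSum` (1–4 combined, `N + #V ≤ cfBound`, a polynomial in the
   size, the formal degree and the number of Boolean variables), `exists_perProjection_matrix`
   (scale by `2`: entries become `2 X_v` or constants `0, ±2, 2c` of `τ ≤ |C_n| + 2`; pad with
   `#V` ones and then twos up to the prescribed p-bounded size `p(n)`, so that
   `per = 2^{p(n)} f_n`), `Burgisser2009_perProjection_holds`, `Burgisser2009_thm210_holds`.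

* `Literature.Computability.AlgebraicComplexity.Burgisser2009_perProjection_holds`
* `Literature.Computability.AlgebraicComplexity.Burgisser2009_thm210_holds : Burgisser2009_thm210`

## References

* P. Bürgisser, *On defining integers and proving arithmetic circuit lower bounds*,
  Comput. Complexity 18 (2009) 81–103, Thm. 2.10 and its proof (ECCC TR06-113, p. 8).
* P. Koiran, *Valiant's model and the cost of computing integers*, Comput. Complexity 13
  (2004) 131–146, Thm. 4.3.
* G. Malod, N. Portier, *Characterizing Valiant's algebraic complexity classes*, J. Complexity
  24 (2008) 16–38, Thm. 2 (`VNP = VNP_e` by parse trees), Lemma 2.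
* P. Bürgisser, M. Clausen, M. A. Shokrollahi, *Algebraic Complexity Theory*, Springer 1997,
  (21.27)–(21.30) (Valiant's universality and completeness of the permanent).
-/

namespace Literature.Computability.AlgebraicComplexity

open MvPolynomial Finset Matrix

/-! ### The permanent of a constant-free circuit's Boolean sum -/

namespace NCirc

variable {R : Type} [CommRing R] (N : NCirc R) (D : ℕ) (hD : 1 ≤ D)

/-- The parameters of the factors of the factor system are parameters of the nodes (or `1`). [folklore] -/
theorem paramIn_kindF (Q : R → Prop) (h1 : Q 1) (hN : ∀ i, (N.kind i).ParamIn Q) (f : Fin (N.mF D)) :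
    (N.kindF D hD f).ParamIn Q := by
  unfold kindF
  rcases N.dec D f with κ | ⟨z⟩ | k
  · simp only [kindΦ_inl]
    by_cases hv : N.CValid D κ
    · rw [N.cloneKind_eq D κ hv rfl]
      have key : ∀ (k : NK R) (hk : N.kind κ.1.val = k), (N.cloneKindOf D κ hv k hk).ParamIn Q := by
        intro k hk
        have hp := hN κ.1.val
        rw [hk] at hp
        cases k with
        | leaf ℓ => exact hp
        | evar =>
          simp only [cloneKindOf]
          have e2 : ∀ (c : ℕ) (hc : κ.2.val = c) hu hc', (N.evarKind D κ hu hc' c hc).ParamIn Q := by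
            intro c hc hu hc'
            cases c <;> trivial
          exact e2 _ rfl _ _
        | mul a b => trivial
        | add a b => trivial
        | pass c a => exact hp
      exact key _ rfl
    · rw [N.cloneKind_of_not D κ hv]
      exact h1
  · simp only [kindΦ_root]; trivial
  · simp only [kindΦ_fin]; trivial

end NCirc

namespace ArithCircuit

variable {S : Type} {u : ℕ}

/-- The size bound of the matrix and of the power of two, in terms of the circuit size `s`, its
formal degree `δ` and the number `u` of Boolean variables. [folklore] -/
def cfBound (s δ u : ℕ) : ℕ := 34 * (u + 5 * s + 2) * ((s + 1) * δ + 2) + 13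

/-- **The permanent form of the Boolean sum of a constant-free circuit**: a matrix with entries
`0, ±1, X v` or cheap constants whose permanent is `2^K · ∑_e P(X, e)`. [cite: Burgisser2006, Thm. 2.10] -/
theorem exists_permanent_boolSum [Fintype S] (P : ArithCircuit ℤ (S ⊕ Fin u)) (h2 : P.IsFanInTwo)
    (hsc : P.HasSignConstants) :
    ∃ (N K : ℕ) (B : Matrix (Fin N) (Fin N) (MvPolynomial S ℤ)),
      N + K ≤ cfBound P.gates.length P.formalDegree u ∧
      (∀ a b, GoodParam P.gates.length (B a b)) ∧ B.permanent = 2 ^ K * boolSum P.eval := by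
  -- the normalized circuit and its budget
  set N₀ := P.toNCirc with hN₀
  set s := P.gates.length
  set D := (s + 1) * P.formalDegree + 1 with hDdef
  have hD : 1 ≤ D := by omega
  have hm : 0 < N₀.m := by show 0 < u + 5 * s + 2; omega
  have hm1 : N₀.m - 1 = u + 5 * s + 1 := by show u + 5 * s + 2 - 1 = _; omega
  have hroot : N₀.fd (N₀.m - 1) ≤ D := by rw [hm1]; exact P.fd_root h2
  -- the factor system and its permanent
  obtain ⟨N, B, hN, hB, F, hF, hper⟩ := (N₀.FS D hD hm hroot).exists_permanent (GoodParam s)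
    (Or.inl rfl) (Or.inr (Or.inl rfl)) (Or.inr (Or.inr (Or.inl rfl)))
    (fun f => N₀.paramIn_kindF D hD (GoodParam s) (Or.inr (Or.inl rfl)) (P.paramIn_kindC h2 hsc) f)
  refine ⟨N, Fintype.card (N₀.Var D), B, ?_, hB, ?_⟩
  · -- the size bound
    have hV : Fintype.card (N₀.Var D) ≤ 2 * ((u + 5 * s + 2) * (D + 1)) + 1 + u * (D + 1) := by
      simp only [NCirc.Var, NCirc.Tok, NCirc.Aux, NCirc.Clone, Fintype.card_sum, Fintype.card_unit]
      have hm' : N₀.m = u + 5 * s + 2 := rfl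
      have hu' : N₀.u = u := rfl
      have h1 : Fintype.card {p : (Fin N₀.m × Fin (D + 1)) × Fin 2 //
          N₀.CValid D p.1 ∧ p.2.val < (N₀.kind p.1.1.val).ar} ≤ (u + 5 * s + 2) * (D + 1) * 2 := by
        have := Fintype.card_subtype_le
          (fun p : (Fin N₀.m × Fin (D + 1)) × Fin 2 => N₀.CValid D p.1 ∧ p.2.val < (N₀.kind p.1.1.val).ar)
        simp only [Fintype.card_prod, Fintype.card_fin] at this
        calc _ ≤ N₀.m * (D + 1) * 2 := this
          _ = (u + 5 * s + 2) * (D + 1) * 2 := by rw [hm']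
      have h2 : Fintype.card {q : Fin N₀.u × Fin (D + 1) // q.2.val + 1 ≤ D} ≤ u * (D + 1) := by
        have := Fintype.card_subtype_le (fun q : Fin N₀.u × Fin (D + 1) => q.2.val + 1 ≤ D)
        simp only [Fintype.card_prod, Fintype.card_fin] at this
        calc _ ≤ N₀.u * (D + 1) := this
          _ = u * (D + 1) := by rw [hu']
      omega
    have hmF : (N₀.FS D hD hm hroot).m = (u + 5 * s + 2) * (D + 1) + (1 + u) := rfl
    have hVV : Fintype.card (N₀.FS D hD hm hroot).V = Fintype.card (N₀.Var D) := rfl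
    rw [hmF, hVV] at hN
    have key : N + Fintype.card (N₀.Var D) ≤ 34 * (u + 5 * s + 2) * (D + 1) + 13 := by
      nlinarith [Nat.zero_le (u * (D + 1)), Nat.zero_le ((u + 5 * s + 2) * (D + 1))]
    have hD1 : D + 1 = (s + 1) * P.formalDegree + 2 := by omega
    calc N + Fintype.card (N₀.Var D) ≤ 34 * (u + 5 * s + 2) * (D + 1) + 13 := key
      _ = cfBound s P.formalDegree u := by unfold cfBound; rw [hD1]
  · -- the permanent
    have hVV : Fintype.card (N₀.FS D hD hm hroot).V = Fintype.card (N₀.Var D) := rfl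
    have h := N₀.sum_prod_factors D hD hm hroot F hF
    rw [hper, hVV, show (∑ b : (N₀.FS D hD hm hroot).V → Bool, ∏ f : Fin (N₀.FS D hD hm hroot).m, F f b) = _
      from h]
    congr 1
    unfold boolSum
    refine Finset.sum_congr rfl fun e _ => ?_
    rw [hm1]
    exact P.val_root h2 e

/-! ### Scaling and padding -/

/-- `2 ·` a good parameter is an admissible entry of `Burgisser2009_perProjection`. [folklore] -/
theorem isPerProjectionEntry_two_mul {s p : ℕ} (hps : s + 2 ≤ p) {x : MvPolynomial S ℤ} (hx : GoodParam s x) :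
    IsPerProjectionEntry p (2 * x) := by
  rcases hx with rfl | rfl | rfl | ⟨v, rfl⟩ | ⟨c, rfl, hc⟩
  · exact Or.inr ⟨0, by simp, by simp⟩
  · refine Or.inr ⟨2, by simp, ?_⟩
    exact constantFreeComplexity_C_two_le.trans (by omega)
  · refine Or.inr ⟨-2, by simp, ?_⟩
    have : (C (-2) : MvPolynomial S ℤ) = C 2 * C (-1) := by rw [← C_mul]; norm_num
    rw [this]
    refine (constantFreeComplexity_mul_le _ _).trans ?_
    rw [constantFreeComplexity_C_neg_one]
    have := constantFreeComplexity_C_two_le (σ := S)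
    omega
  · exact Or.inl ⟨v, by simp⟩
  · refine Or.inr ⟨2 * c, by simp, ?_⟩
    rw [C_mul]
    refine (constantFreeComplexity_mul_le _ _).trans ?_
    have := constantFreeComplexity_C_two_le (σ := S)
    omega

/-- Constants `0`, `1`, `2` are admissible entries. [folklore] -/
theorem isPerProjectionEntry_ite {p : ℕ} (hp : 1 ≤ p) (c : Prop) [Decidable c] (a : ℤ) (ha : a = 1 ∨ a = 2) :
    IsPerProjectionEntry p ((if c then C a else 0 : MvPolynomial S ℤ)) := by
  split_ifs
  · refine Or.inr ⟨a, rfl, ?_⟩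
    rcases ha with rfl | rfl
    · simp
    · exact constantFreeComplexity_C_two_le.trans hp
  · exact Or.inr ⟨0, by simp, by simp⟩

/-- **Scaling and padding**: from `per B = 2^K q` with good entries to a `p × p` matrix with
admissible entries and `per = 2^p q`, for any `p ≥ N + K`, `p ≥ s + 2`: scale `B` by `2`, pad with
`K` ones and `p - N - K` twos on the diagonal. [cite: Burgisser2006, proof of Thm. 2.10] -/
theorem exists_perProjection_matrix (q : MvPolynomial S ℤ) {N K s : ℕ} (B : Matrix (Fin N) (Fin N) (MvPolynomial S ℤ))
    (hB : ∀ a b, GoodParam s (B a b)) (hper : B.permanent = 2 ^ K * q) (p : ℕ) (hp : N + K ≤ p)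
    (hps : s + 2 ≤ p) :
    ∃ B' : Matrix (Fin p) (Fin p) (MvPolynomial S ℤ),
      (∀ i j, IsPerProjectionEntry p (B' i j)) ∧ B'.permanent = C ((2 : ℤ) ^ p) * q := by
  set t := p - N - K with ht
  -- the padded matrix on `(Fin N ⊕ Fin K) ⊕ Fin t`
  let M : Matrix ((Fin N ⊕ Fin K) ⊕ Fin t) ((Fin N ⊕ Fin K) ⊕ Fin t) (MvPolynomial S ℤ) :=
    fromBlocks (fromBlocks ((2 : MvPolynomial S ℤ) • B) 0 0 1) 0 0 ((2 : MvPolynomial S ℤ) • 1)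
  have hMper : M.permanent = 2 ^ p * q := by
    simp only [M]
    rw [permanent_fromBlocks_zero₁₂, permanent_fromBlocks_zero₁₂, permanent_smul, permanent_smul,
      permanent_one, permanent_one, hper, Fintype.card_fin, Fintype.card_fin, mul_one, mul_one]
    have : p = N + K + t := by omega
    rw [this]; ring
  -- reindex to `Fin p`
  let e : Fin p ≃ (Fin N ⊕ Fin K) ⊕ Fin t :=
    (finCongr (by omega : p = N + K + t)).trans (finSumFinEquiv.symm.trans (Equiv.sumCongr finSumFinEquiv.symm (Equiv.refl _)))
  refine ⟨M.submatrix e e, fun i j => ?_, ?_⟩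
  · -- entries
    simp only [submatrix_apply]
    have hp1 : 1 ≤ p := by omega
    rcases e i with (a | a) | a <;> rcases e j with (b | b) | b
    · simp only [M, fromBlocks_apply₁₁, Matrix.smul_apply, smul_eq_mul]
      exact isPerProjectionEntry_two_mul hps (hB a b)
    · simp only [M, fromBlocks_apply₁₁, fromBlocks_apply₁₂, Matrix.zero_apply]
      exact Or.inr ⟨0, by simp, by simp⟩
    · simp only [M, fromBlocks_apply₁₂, Matrix.zero_apply]
      exact Or.inr ⟨0, by simp, by simp⟩
    · simp only [M, fromBlocks_apply₁₁, fromBlocks_apply₂₁, Matrix.zero_apply]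
      exact Or.inr ⟨0, by simp, by simp⟩
    · simp only [M, fromBlocks_apply₁₁, fromBlocks_apply₂₂, Matrix.one_apply]
      have := isPerProjectionEntry_ite (S := S) hp1 (a = b) 1 (Or.inl rfl)
      simpa using this
    · simp only [M, fromBlocks_apply₁₂, Matrix.zero_apply]
      exact Or.inr ⟨0, by simp, by simp⟩
    · simp only [M, fromBlocks_apply₂₁, Matrix.zero_apply]
      exact Or.inr ⟨0, by simp, by simp⟩
    · simp only [M, fromBlocks_apply₂₁, Matrix.zero_apply]
      exact Or.inr ⟨0, by simp, by simp⟩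
    · simp only [M, fromBlocks_apply₂₂, Matrix.smul_apply, Matrix.one_apply, smul_eq_mul, mul_ite, mul_one,
        mul_zero]
      have := isPerProjectionEntry_ite (S := S) hp1 (a = b) 2 (Or.inr rfl)
      simpa [map_ofNat] using this
  · rw [permanent_submatrix_equiv, hMper, C_pow]
    simp [map_ofNat]

end ArithCircuit

/-! ### The theorems -/

/-- `cfBound` is p-bounded along p-bounded size, formal degree and number of Boolean variables. [folklore] -/
theorem isPBounded_cfBound {s δ u : ℕ → ℕ} (hs : IsPBounded s) (hδ : IsPBounded δ) (hu : IsPBounded u) :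
    IsPBounded fun n => ArithCircuit.cfBound (s n) (δ n) (u n) := by
  unfold ArithCircuit.cfBound
  exact IsPBounded.add_holds
    (IsPBounded.mul_holds (IsPBounded.mul_holds (IsPBounded.const 34)
      (IsPBounded.add_holds (IsPBounded.add_holds hu (IsPBounded.mul_holds (IsPBounded.const 5) hs))
        (IsPBounded.const 2)))
      (IsPBounded.add_holds (IsPBounded.mul_holds (IsPBounded.add_holds hs (IsPBounded.const 1)) hδ)
        (IsPBounded.const 2)))
    (IsPBounded.const 13)

/-- **Discharge of `Burgisser2009_perProjection`** (the algebraic content of Bürgisser 2009,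
Thm. 2.10 = Koiran 2004, Thm. 4.3): every `VNP⁰` family is, for p-bounded `p`, the permanent of
a `p(n) × p(n)` matrix with entries `2 X_v` or cheap integer constants, up to the factor
`2^{p(n)}`. Proof: the `VP⁰` circuit of `g_n` becomes a normalized circuit (`VP0Normal.lean`),
its clones and tokens a factor system read twice per variable (`TokenCircuits.lean`) whose
permanent form is `2^{#V} ∑_b ∏ F` (`FactorSystems.lean`, the read-once kit and the two-site
Boolean-sum gadget), and `∑_b ∏ F = ∑_e g_n(X, e) = f_n` by the token expansion
(`TokenExpansionMain.lean`); finally scale by `2` and pad. [cite: Burgisser2006, Thm. 2.10] -/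
theorem Burgisser2009_perProjection_holds : Burgisser2009_perProjection := by
  intro σ _ f hf
  obtain ⟨u, g, ⟨hcard, Cn, hC, hsize, hfdeg⟩, hfg⟩ := hf
  have hu : IsPBounded u := hcard.mono fun n => by simp
  refine ⟨fun n => ArithCircuit.cfBound (Cn n).size (Cn n).formalDegree (u n) + (Cn n).size + 2,
    IsPBounded.add_holds (IsPBounded.add_holds (isPBounded_cfBound hsize hfdeg hu) hsize) (IsPBounded.const 2),
    fun n => ?_⟩
  obtain ⟨N, K, B, hNK, hB, hper⟩ := ArithCircuit.exists_permanent_boolSum (Cn n) (hC n).1 (hC n).2.1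
  have heval : (Cn n).eval = g n := (hC n).2.2
  rw [heval, ← hfg n] at hper
  refine ArithCircuit.exists_perProjection_matrix (f n) B hB hper _ ?_ ?_
  · show N + K ≤ ArithCircuit.cfBound (Cn n).size (Cn n).formalDegree (u n) + (Cn n).size + 2
    unfold ArithCircuit.size; omega
  · show (Cn n).gates.length + 2 ≤ ArithCircuit.cfBound (Cn n).size (Cn n).formalDegree (u n) + (Cn n).size + 2
    unfold ArithCircuit.size; omega

/-- **Bürgisser 2009, Thm. 2.10** (= Koiran 2004, Thm. 4.3), discharged:
`τ(PER_n) = n^{O(1)} ⟹ ∀ (f_n) ∈ VNP⁰ ∃ p, τ(2^{p(n)} f_n) = n^{O(1)}`. [cite: Burgisser2006, Thm. 2.10] -/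
theorem Burgisser2009_thm210_holds : Burgisser2009_thm210 :=
  Burgisser2009_thm210_of Burgisser2009_perProjection_holds

end Literature.Computability.AlgebraicComplexity
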